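import Literature.Analysis.Fourier.RadialSchwartzInterpolation
import Literature.Analysis.FunctionSpaces.GaussianSchwartz
import Mathlib.Analysis.SpecialFunctions.Gaussian.FourierTransform
import Mathlib.Analysis.Complex.UpperHalfPlane.Basic
import HarnessLib

/-!
# CKMRV interpolation, step 1: complex Gaussians and the functional equation (1.8)

Sibling of `Literature/Analysis/Fourier/RadialSchwartzInterpolation.lean` (the named fact
`CKMRV2022_interpolationFormula` = Cohn–Kumar–Miller–Radchenko–Viazovska, Ann. Math. 196 (2022),
Theorem 1.7). This file formalizes, with proofs, the first step of the printed proof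
(§1.5, equations (1.6)–(1.8), and the last paragraph of the proof of Theorem 3.1):

* the **complex Gaussian** `x ↦ e^{πiτ|x|²}` (`τ` in the upper half-plane `ℍ`) as a radial
  Schwartz function on a real inner product space (`complexGaussian E τ`), its values
  `e^{πiτ r²}` and radial derivatives `2πiτ r e^{πiτ r²}`, in particular the data
  `e^{2πinτ}` and `2πiτ √(2n) e^{2πinτ}` at the nodes `√(2n)` (CKMRV §1.5: "because
  `p(√(2n)) = e^{2πinτ}` and `p′(√(2n)) = 2πiτ√(2n) e^{2πinτ}`");
* its Fourier transform, "the Fourier transform of `x ↦ e^{πiτ|x|²}` as a function on `ℝᵈ` is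
  `x ↦ (i/τ)^{d/2} e^{πi(−1/τ)|x|²}`" (CKMRV §1.5), from Mathlib's
  `fourier_gaussian_innerProductSpace` (the power is the principal-branch complex power
  `(i/τ)^{d/2}`, an honest integer power when `d` is even: `fourier_complexGaussian_eq_pow`);
* the **generating functions** (1.6)–(1.7) = (3.1)–(3.2)
  `F(τ,x) = ∑ aₙ(x) e^{2πinτ} + 2πiτ ∑ √(2n) bₙ(x) e^{2πinτ}` of a family (`genFun`), and the
  computation behind (1.8): for every family `a, b, ã, b̃` the right-hand side of the
  interpolation formula (1.4) at `f = e^{πiτ|·|²}` IS `F(τ,x) + (i/τ)^{d/2} F̃(−1/τ,x)`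
  (`interpolationSum_complexGaussian`), so that (1.4) for complex Gaussians is equivalent to the
  functional equation (1.8) `F(τ,x) + (i/τ)^{d/2} F̃(−1/τ,x) = e^{πiτ|x|²}`
  (`IsInterpolationBasis.genFun_functionalEquation`, and conversely
  `eq_interpolationSum_complexGaussian_of_functionalEquation`, the form used at the end of the
  proof of CKMRV Theorem 3.1).

Everything here is proved; no named facts are introduced. What is NOT here: the density of
complex Gaussians in `𝓢_rad(ℝᵈ)` (CKMRV Lemma 2.2), Theorem 3.1 itself, and the modular-form
kernels of §4–§5.

## References

* H. Cohn, A. Kumar, S. D. Miller, D. Radchenko, M. Viazovska, *Universal optimality of the `E₈`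
  and Leech lattices and interpolation formulas*, Ann. of Math. 196 (2022) 983–1082,
  arXiv:1902.05438: §1.5 (eqs. (1.5)–(1.8)), §3.1 (eqs. (3.1)–(3.2), Theorem 3.1 and the last
  paragraph of its proof). [CohnEtAl2019]
-/

noncomputable section

open scoped SchwartzMap FourierTransform Topology UpperHalfPlane ContDiff
open Filter Complex

namespace Literature.Analysis.Fourier

/-! ## Temperate growth of the phase `e^{ic|x|²}` -/

/-- `s ↦ e^{is}` has all derivatives of modulus `1`, hence temperate growth. [folklore] -/
theorem hasTemperateGrowth_cexp_ofReal_mul_I :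
    (fun s : ℝ => cexp ((s : ℂ) * I)).HasTemperateGrowth := by
  set e : ℝ → ℂ := fun s => cexp ((s : ℂ) * I) with he
  have hd : ∀ s, HasDerivAt e (e s * I) s := fun s => by
    have h := ((hasDerivAt_id s).ofReal_comp.mul_const I).cexp
    simpa [he] using h
  have hderiv : deriv e = fun s => e s * I := funext fun s => (hd s).deriv
  have hiter : ∀ n : ℕ, iteratedDeriv n e = fun s => e s * I ^ n := by
    intro n
    induction n with
    | zero => funext s; simp [iteratedDeriv_zero]
    | succ n ih =>
        rw [iteratedDeriv_succ, ih]
        funext s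
        rw [deriv_mul_const (hd s).differentiableAt, hderiv]
        ring
  have hcd : ContDiff ℝ ∞ e :=
    Complex.contDiff_exp.comp (Complex.ofRealCLM.contDiff.mul contDiff_const)
  refine ⟨hcd, fun n => ⟨0, 1, fun s => ?_⟩⟩
  rw [norm_iteratedFDeriv_eq_norm_iteratedDeriv, hiter]
  simp [he, Complex.norm_exp_ofReal_mul_I]

variable {E : Type*} [NormedAddCommGroup E] [InnerProductSpace ℝ E]

variable (E) in
/-- The phase `x ↦ e^{ic|x|²}` (`c` real) has temperate growth on a real inner product space:
it is `e^{is}` composed with the temperate `x ↦ c|x|²`. [folklore] -/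
theorem hasTemperateGrowth_cexp_mul_norm_sq_mul_I (c : ℝ) :
    (fun x : E => cexp (((c * ‖x‖ ^ 2 : ℝ) : ℂ) * I)).HasTemperateGrowth := by
  have h := hasTemperateGrowth_cexp_ofReal_mul_I.comp
    ((Function.HasTemperateGrowth.const c).mul (Function.hasTemperateGrowth_norm_sq E))
  exact h

/-! ## The complex Gaussian `e^{πiτ|x|²}`, `τ ∈ ℍ` -/

variable (E) in
/-- The **complex Gaussian** `x ↦ e^{πiτ|x|²}` on a real inner product space, for `τ` in the
upper half-plane, as a Schwartz function (CKMRV §1.5 and Lemma 2.2: "complex Gaussians of the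
form `x ↦ e^{πiτ|x|²}` with `τ ∈ ℍ`"): the real Gaussian `e^{-π Im(τ)|x|²}`
(`Literature.Analysis.FunctionSpaces.gaussianSchwartz`) multiplied by the temperate phase
`e^{πi Re(τ)|x|²}`. [cite: CohnEtAl2019, §1.5] -/
def complexGaussian (τ : ℍ) : 𝓢(E, ℂ) :=
  SchwartzMap.smulLeftCLM ℂ (fun x : E => cexp (((Real.pi * τ.re * ‖x‖ ^ 2 : ℝ) : ℂ) * I))
    (FunctionSpaces.gaussianSchwartz E (Real.pi * τ.im))

/-- Values of the complex Gaussian: `e^{πiτ|x|²}`. [cite: CohnEtAl2019, §1.5] -/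
@[simp]
theorem complexGaussian_apply (τ : ℍ) (x : E) :
    complexGaussian E τ x = cexp (Real.pi * I * (τ : ℂ) * ‖x‖ ^ 2) := by
  have hτ : 0 < Real.pi * τ.im := mul_pos Real.pi_pos τ.im_pos
  rw [complexGaussian, SchwartzMap.smulLeftCLM_apply_apply
    (hasTemperateGrowth_cexp_mul_norm_sq_mul_I E (Real.pi * τ.re)),
    FunctionSpaces.gaussianSchwartz_apply hτ, smul_eq_mul, Complex.ofReal_exp, ← Complex.exp_add]
  congr 1
  have h : (τ : ℂ) = ((τ : ℂ).re : ℂ) + ((τ : ℂ).im : ℂ) * I := (Complex.re_add_im _).symm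
  rw [h]
  push_cast
  simp only [UpperHalfPlane.coe_re, UpperHalfPlane.coe_im]
  ring_nf
  rw [I_sq]
  ring

/-- The complex Gaussian as a function. [cite: CohnEtAl2019, §1.5] -/
theorem coe_complexGaussian (τ : ℍ) :
    ⇑(complexGaussian E τ) = fun x : E => cexp (Real.pi * I * (τ : ℂ) * ‖x‖ ^ 2) :=
  funext (complexGaussian_apply τ)

/-- The complex Gaussian is radial. [cite: CohnEtAl2019, §1.5] -/
theorem isRadial_complexGaussian (τ : ℍ) : IsRadial (complexGaussian E τ) := by
  intro x y h
  simp only [complexGaussian_apply, h]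

/-! ## Values and radial derivatives on `ℝᵈ`; the data at the nodes `√(2m)` -/

section Euclidean

variable {d : ℕ} [NeZero d]

/-- `f(r) = e^{πiτr²}` for the complex Gaussian `f = e^{πiτ|·|²}`. [cite: CohnEtAl2019, §1.5] -/
theorem radialValue_complexGaussian (τ : ℍ) (r : ℝ) :
    radialValue (complexGaussian (EuclideanSpace ℝ (Fin d)) τ) r =
      cexp (Real.pi * I * (τ : ℂ) * (r : ℂ) ^ 2) := by
  rw [radialValue_def, complexGaussian_apply, norm_axisPt]
  congr 2
  norm_cast
  exact sq_abs r

/-- Along the axis `t ↦ t e₀` the complex Gaussian is the one-variable `e^{πiτt²}`. [folklore] -/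
theorem complexGaussian_axisPt (τ : ℍ) :
    (fun t : ℝ => complexGaussian (EuclideanSpace ℝ (Fin d)) τ (axisPt d t)) =
      fun t : ℝ => cexp (Real.pi * I * (τ : ℂ) * (t : ℂ) ^ 2) :=
  funext fun t => radialValue_complexGaussian τ t

/-- The one-variable profile `t ↦ e^{πiτt²}` has derivative `2πiτ t e^{πiτt²}`. [folklore] -/
theorem hasDerivAt_cexp_quadratic (c : ℂ) (t : ℝ) :
    HasDerivAt (fun t : ℝ => cexp (c * (t : ℂ) ^ 2)) (2 * c * t * cexp (c * (t : ℂ) ^ 2)) t := by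
  have h1 : HasDerivAt (fun t : ℝ => c * (t : ℂ) ^ 2) (c * (2 * (t : ℂ))) t := by
    have h := ((hasDerivAt_id t).ofReal_comp.pow 2).const_mul c
    simpa using h
  have h2 := h1.cexp
  convert h2 using 1
  ring

/-- `f′(r) = 2πiτ r e^{πiτr²}` for the complex Gaussian (its radial derivative).
[cite: CohnEtAl2019, §1.5] -/
theorem radialDeriv_complexGaussian (τ : ℍ) (r : ℝ) :
    radialDeriv (complexGaussian (EuclideanSpace ℝ (Fin d)) τ) r =
      2 * Real.pi * I * (τ : ℂ) * r * cexp (Real.pi * I * (τ : ℂ) * (r : ℂ) ^ 2) := by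
  rw [radialDeriv_def, complexGaussian_axisPt, (hasDerivAt_cexp_quadratic _ r).deriv]
  ring

/-- `e^{πiτ · 2m} = e^{2πimτ}` at the node `√(2m)`, `m = n₀ + n`. [folklore] -/
theorem cexp_node_sq (τ : ℂ) (n₀ n : ℕ) :
    cexp (Real.pi * I * τ * (node n₀ n : ℂ) ^ 2) = cexp (2 * Real.pi * I * ((n₀ : ℂ) + n) * τ) := by
  congr 1
  have h : ((node n₀ n : ℝ) : ℂ) ^ 2 = 2 * ((n₀ : ℂ) + n) := by
    rw [← Complex.ofReal_pow, node_sq]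
    push_cast
    ring
  rw [h]
  ring

/-- **The values of the complex Gaussian at the nodes**: `f(√(2m)) = e^{2πimτ}` (CKMRV §1.5,
"`p(√(2n)) = e^{2πinτ}`"). [cite: CohnEtAl2019, §1.5] -/
theorem radialValue_complexGaussian_node (τ : ℍ) (n₀ n : ℕ) :
    radialValue (complexGaussian (EuclideanSpace ℝ (Fin d)) τ) (node n₀ n) =
      cexp (2 * Real.pi * I * ((n₀ : ℂ) + n) * (τ : ℂ)) := by
  rw [radialValue_complexGaussian, cexp_node_sq]

/-- **The radial derivatives of the complex Gaussian at the nodes**: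
`f′(√(2m)) = 2πiτ √(2m) e^{2πimτ}` (CKMRV §1.5, "`p′(√(2n)) = 2πiτ √(2n) e^{2πinτ}`").
[cite: CohnEtAl2019, §1.5] -/
theorem radialDeriv_complexGaussian_node (τ : ℍ) (n₀ n : ℕ) :
    radialDeriv (complexGaussian (EuclideanSpace ℝ (Fin d)) τ) (node n₀ n) =
      2 * Real.pi * I * (τ : ℂ) * (node n₀ n : ℂ) * cexp (2 * Real.pi * I * ((n₀ : ℂ) + n) * (τ : ℂ)) := by
  rw [radialDeriv_complexGaussian, cexp_node_sq]

end Euclidean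

/-! ## The Fourier transform of the complex Gaussian -/

/-- `−1/τ ∈ ℍ` for `τ ∈ ℍ` (the image of `τ` under `S = (0 −1; 1 0)`; Mathlib's
`UpperHalfPlane.modular_S_smul`). [folklore] -/
def UpperHalfPlane.negInv (τ : ℍ) : ℍ :=
  UpperHalfPlane.mk (-(τ : ℂ))⁻¹ τ.im_inv_neg_coe_pos

/-- `↑(−1/τ) = −τ⁻¹`. [folklore] -/
@[simp]
theorem UpperHalfPlane.coe_negInv (τ : ℍ) : (UpperHalfPlane.negInv τ : ℂ) = -(τ : ℂ)⁻¹ := by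
  rw [UpperHalfPlane.negInv, UpperHalfPlane.coe_mk, inv_neg]

section Fourier

variable [FiniteDimensional ℝ E] [MeasurableSpace E] [BorelSpace E]

/-- The parameter `b = −πiτ` of the complex Gaussian `e^{πiτ|x|²} = e^{−b|x|²}` has positive real
part `π Im τ`. [folklore] -/
theorem re_neg_pi_mul_I_mul_pos (τ : ℍ) : 0 < (-(Real.pi : ℂ) * I * (τ : ℂ)).re := by
  have h : (-(Real.pi : ℂ) * I * (τ : ℂ)).re = Real.pi * τ.im := by
    simp [Complex.mul_re, Complex.mul_im, UpperHalfPlane.coe_im]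
  rw [h]
  exact mul_pos Real.pi_pos τ.im_pos

/-- **Fourier transform of the complex Gaussian** (CKMRV §1.5: "the Fourier transform of
`x ↦ e^{πiτ|x|²}` as a function on `ℝᵈ` is `x ↦ (i/τ)^{d/2} e^{πi(−1/τ)|x|²}`"), with
Mathlib's = CKMRV's normalisation `f̂(ξ) = ∫ f(x) e^{−2πi⟨x,ξ⟩} dx`; here `d = dim E` and
`(i/τ)^{d/2}` is the principal-branch power (`Re(i/τ) > 0`). From Mathlib's
`fourier_gaussian_innerProductSpace`. [cite: CohnEtAl2019, §1.5] -/
theorem fourier_complexGaussian_apply (τ : ℍ) (w : E) :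
    (𝓕 (complexGaussian E τ)) w = (I / (τ : ℂ)) ^ ((Module.finrank ℝ E : ℂ) / 2) *
      complexGaussian E (UpperHalfPlane.negInv τ) w := by
  have hτ : (τ : ℂ) ≠ 0 := τ.ne_zero
  set b : ℂ := -(Real.pi : ℂ) * I * (τ : ℂ) with hb
  have hbre : 0 < b.re := re_neg_pi_mul_I_mul_pos τ
  have hb0 : b ≠ 0 := fun h0 => by rw [h0, Complex.zero_re] at hbre; exact lt_irrefl _ hbre
  have hfun : (⇑(complexGaussian E τ) : E → ℂ) = fun v : E => cexp (-b * ‖v‖ ^ 2) := by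
    funext v
    rw [complexGaussian_apply]
    congr 1
    simp only [hb]
    ring
  rw [SchwartzMap.fourier_coe, hfun, fourier_gaussian_innerProductSpace hbre w,
    complexGaussian_apply, UpperHalfPlane.coe_negInv]
  have h1 : (Real.pi : ℂ) / b = I / (τ : ℂ) := by
    rw [div_eq_div_iff hb0 hτ, hb]
    linear_combination (Real.pi : ℂ) * (τ : ℂ) * I_sq
  have h2 : -(Real.pi : ℂ) ^ 2 * ‖w‖ ^ 2 / b = Real.pi * I * (-(τ : ℂ)⁻¹) * ‖w‖ ^ 2 := by
    rw [div_eq_iff hb0, hb]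
    field_simp
    linear_combination -(‖w‖ : ℂ) ^ 2 * I_sq
  rw [h1, h2]

/-- The Fourier transform of the complex Gaussian when `dim E = 2k` is even:
`𝓕 e^{πiτ|·|²} = (i/τ)ᵏ e^{πi(−1/τ)|·|²}` with an honest integer power. [cite: CohnEtAl2019, §1.5] -/
theorem fourier_complexGaussian_eq_pow (τ : ℍ) {k : ℕ} (hk : Module.finrank ℝ E = 2 * k) (w : E) :
    (𝓕 (complexGaussian E τ)) w = (I / (τ : ℂ)) ^ k *
      complexGaussian E (UpperHalfPlane.negInv τ) w := by
  rw [fourier_complexGaussian_apply, hk]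
  congr 1
  rw [← cpow_natCast]
  congr 1
  push_cast
  ring

/-- The Fourier transform of the complex Gaussian is radial. [cite: CohnEtAl2019, §1.4] -/
theorem isRadial_fourier_complexGaussian (τ : ℍ) :
    IsRadial (𝓕 (complexGaussian E τ) : 𝓢(E, ℂ)) := by
  intro x y h
  rw [fourier_complexGaussian_apply, fourier_complexGaussian_apply, isRadial_complexGaussian _ h]

end Fourier

/-! ## The data of `f̂` for `f = e^{πiτ|·|²}` on `ℝᵈ` -/

section EuclideanFourier

variable {d : ℕ} [NeZero d]

/-- `f̂(r) = (i/τ)^{d/2} g(r)` with `g = e^{πi(−1/τ)|·|²}`, for `f = e^{πiτ|·|²}` on `ℝᵈ`.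
[cite: CohnEtAl2019, §1.5] -/
theorem radialValue_fourier_complexGaussian (τ : ℍ) (r : ℝ) :
    radialValue (𝓕 (complexGaussian (EuclideanSpace ℝ (Fin d)) τ) : 𝓢(EuclideanSpace ℝ (Fin d), ℂ)) r =
      (I / (τ : ℂ)) ^ ((d : ℂ) / 2) *
        radialValue (complexGaussian (EuclideanSpace ℝ (Fin d)) (UpperHalfPlane.negInv τ)) r := by
  rw [radialValue_def, fourier_complexGaussian_apply, finrank_euclideanSpace_fin, radialValue_def]

/-- `f̂′(r) = (i/τ)^{d/2} g′(r)` with `g = e^{πi(−1/τ)|·|²}`, for `f = e^{πiτ|·|²}` on `ℝᵈ`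
(radial derivatives). [cite: CohnEtAl2019, §1.5] -/
theorem radialDeriv_fourier_complexGaussian (τ : ℍ) (r : ℝ) :
    radialDeriv (𝓕 (complexGaussian (EuclideanSpace ℝ (Fin d)) τ) : 𝓢(EuclideanSpace ℝ (Fin d), ℂ)) r =
      (I / (τ : ℂ)) ^ ((d : ℂ) / 2) *
        radialDeriv (complexGaussian (EuclideanSpace ℝ (Fin d)) (UpperHalfPlane.negInv τ)) r := by
  have hfun : (fun t : ℝ => (𝓕 (complexGaussian (EuclideanSpace ℝ (Fin d)) τ) :
      𝓢(EuclideanSpace ℝ (Fin d), ℂ)) (axisPt d t)) = fun t : ℝ =>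
      (I / (τ : ℂ)) ^ ((d : ℂ) / 2) *
        complexGaussian (EuclideanSpace ℝ (Fin d)) (UpperHalfPlane.negInv τ) (axisPt d t) := by
    funext t
    rw [fourier_complexGaussian_apply, finrank_euclideanSpace_fin]
  rw [radialDeriv_def, hfun, deriv_const_mul_field,
    radialDeriv_def (complexGaussian (EuclideanSpace ℝ (Fin d)) (UpperHalfPlane.negInv τ)) r]

/-- The data `f̂(√(2m))` of the complex Gaussian: `(i/τ)^{d/2} e^{2πim(−1/τ)}`.
[cite: CohnEtAl2019, §1.5] -/
theorem radialValue_fourier_complexGaussian_node (τ : ℍ) (n₀ n : ℕ) :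
    radialValue (𝓕 (complexGaussian (EuclideanSpace ℝ (Fin d)) τ) : 𝓢(EuclideanSpace ℝ (Fin d), ℂ))
        (node n₀ n) =
      (I / (τ : ℂ)) ^ ((d : ℂ) / 2) * cexp (2 * Real.pi * I * ((n₀ : ℂ) + n) * (-(τ : ℂ)⁻¹)) := by
  rw [radialValue_fourier_complexGaussian, radialValue_complexGaussian_node, UpperHalfPlane.coe_negInv]

/-- The data `f̂′(√(2m))` of the complex Gaussian:
`(i/τ)^{d/2} · 2πi(−1/τ) √(2m) e^{2πim(−1/τ)}`. [cite: CohnEtAl2019, §1.5] -/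
theorem radialDeriv_fourier_complexGaussian_node (τ : ℍ) (n₀ n : ℕ) :
    radialDeriv (𝓕 (complexGaussian (EuclideanSpace ℝ (Fin d)) τ) : 𝓢(EuclideanSpace ℝ (Fin d), ℂ))
        (node n₀ n) =
      (I / (τ : ℂ)) ^ ((d : ℂ) / 2) * (2 * Real.pi * I * (-(τ : ℂ)⁻¹) * (node n₀ n : ℂ) *
        cexp (2 * Real.pi * I * ((n₀ : ℂ) + n) * (-(τ : ℂ)⁻¹))) := by
  rw [radialDeriv_fourier_complexGaussian, radialDeriv_complexGaussian_node, UpperHalfPlane.coe_negInv]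

end EuclideanFourier

/-! ## The generating functions (1.6)–(1.7) and the functional equation (1.8) -/

section GeneratingFunction

variable {V : Type*}

/-- **The generating function of a family** `(aₙ, bₙ)_{n ≥ n₀}` (CKMRV (1.6) = (3.1), and (1.7) =
(3.2) for `(ãₙ, b̃ₙ)`):
`F(τ, x) = ∑_{m ≥ n₀} aₘ(x) e^{2πimτ} + 2πiτ ∑_{m ≥ n₀} √(2m) bₘ(x) e^{2πimτ}`, written with
`m = n₀ + n`, `n : ℕ` (our enumeration of the nodes, `node n₀ n = √(2m)`), for any complex `τ`
(the series are meant for `τ ∈ ℍ`; `∑'` is `0` on divergence). [cite: CohnEtAl2019, §1.5 (1.6)–(1.7)] -/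
def genFun (n₀ : ℕ) (a b : ℕ → V → ℂ) (τ : ℂ) (x : V) : ℂ :=
  (∑' n : ℕ, a n x * cexp (2 * Real.pi * I * ((n₀ : ℂ) + n) * τ)) +
    2 * Real.pi * I * τ * ∑' n : ℕ, (node n₀ n : ℂ) * b n x * cexp (2 * Real.pi * I * ((n₀ : ℂ) + n) * τ)

/-- `genFun` unfolds. [cite: CohnEtAl2019, §1.5 (1.6)] -/
theorem genFun_def (n₀ : ℕ) (a b : ℕ → V → ℂ) (τ : ℂ) (x : V) :
    genFun n₀ a b τ x = (∑' n : ℕ, a n x * cexp (2 * Real.pi * I * ((n₀ : ℂ) + n) * τ)) +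
      2 * Real.pi * I * τ *
        ∑' n : ℕ, (node n₀ n : ℂ) * b n x * cexp (2 * Real.pi * I * ((n₀ : ℂ) + n) * τ) := rfl

variable {d : ℕ} [NeZero d]

/-- **The interpolation sum at a complex Gaussian is `F(τ,x) + (i/τ)^{d/2} F̃(−1/τ,x)`**
(CKMRV §1.5, derivation of (1.8)): for ANY family `a, b, ã, b̃` of functions on `ℝᵈ`, any
`τ ∈ ℍ` and `x ∈ ℝᵈ`, the right-hand side of (1.4) for `f = e^{πiτ|·|²}`,
`∑ f(√(2m)) aₘ(x) + ∑ f′(√(2m)) bₘ(x) + ∑ f̂(√(2m)) ãₘ(x) + ∑ f̂′(√(2m)) b̃ₘ(x)`, equals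
`F(τ,x) + (i/τ)^{d/2} F̃(−1/τ,x)` with `F = genFun n₀ a b`, `F̃ = genFun n₀ ã b̃` — an identity of
(possibly divergent, then zero) series, no convergence hypothesis needed. [cite: CohnEtAl2019, §1.5 (1.8)] -/
theorem interpolationSum_complexGaussian (n₀ : ℕ) (a b a' b' : ℕ → EuclideanSpace ℝ (Fin d) → ℂ)
    (τ : ℍ) (x : EuclideanSpace ℝ (Fin d)) :
    (∑' n, radialValue (complexGaussian (EuclideanSpace ℝ (Fin d)) τ) (node n₀ n) * a n x) +
      (∑' n, radialDeriv (complexGaussian (EuclideanSpace ℝ (Fin d)) τ) (node n₀ n) * b n x) +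
      (∑' n, radialValue (𝓕 (complexGaussian (EuclideanSpace ℝ (Fin d)) τ) :
        𝓢(EuclideanSpace ℝ (Fin d), ℂ)) (node n₀ n) * a' n x) +
      (∑' n, radialDeriv (𝓕 (complexGaussian (EuclideanSpace ℝ (Fin d)) τ) :
        𝓢(EuclideanSpace ℝ (Fin d), ℂ)) (node n₀ n) * b' n x) =
    genFun n₀ a b τ x + (I / (τ : ℂ)) ^ ((d : ℂ) / 2) * genFun n₀ a' b' (-(τ : ℂ)⁻¹) x := by
  simp only [radialValue_complexGaussian_node, radialDeriv_complexGaussian_node,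
    radialValue_fourier_complexGaussian_node, radialDeriv_fourier_complexGaussian_node, genFun_def]
  rw [mul_add, ← tsum_mul_left, ← tsum_mul_left, ← tsum_mul_left]
  have e1 : ∀ n : ℕ, cexp (2 * Real.pi * I * ((n₀ : ℂ) + n) * (τ : ℂ)) * a n x =
      a n x * cexp (2 * Real.pi * I * ((n₀ : ℂ) + n) * (τ : ℂ)) := fun n => mul_comm _ _
  have e2 : ∀ n : ℕ, 2 * Real.pi * I * (τ : ℂ) * (node n₀ n : ℂ) *
      cexp (2 * Real.pi * I * ((n₀ : ℂ) + n) * (τ : ℂ)) * b n x =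
      2 * Real.pi * I * (τ : ℂ) *
        ((node n₀ n : ℂ) * b n x * cexp (2 * Real.pi * I * ((n₀ : ℂ) + n) * (τ : ℂ))) := fun n => by
    ring
  have e3 : ∀ n : ℕ, (I / (τ : ℂ)) ^ ((d : ℂ) / 2) * cexp (2 * Real.pi * I * ((n₀ : ℂ) + n) * (-(τ : ℂ)⁻¹)) *
      a' n x = (I / (τ : ℂ)) ^ ((d : ℂ) / 2) *
        (a' n x * cexp (2 * Real.pi * I * ((n₀ : ℂ) + n) * (-(τ : ℂ)⁻¹))) := fun n => by ring
  have e4 : ∀ n : ℕ, (I / (τ : ℂ)) ^ ((d : ℂ) / 2) * (2 * Real.pi * I * (-(τ : ℂ)⁻¹) * (node n₀ n : ℂ) *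
      cexp (2 * Real.pi * I * ((n₀ : ℂ) + n) * (-(τ : ℂ)⁻¹))) * b' n x =
      (I / (τ : ℂ)) ^ ((d : ℂ) / 2) * (2 * Real.pi * I * (-(τ : ℂ)⁻¹) *
        ((node n₀ n : ℂ) * b' n x * cexp (2 * Real.pi * I * ((n₀ : ℂ) + n) * (-(τ : ℂ)⁻¹)))) :=
    fun n => by ring
  simp only [e1, e2, e3, e4]
  rw [tsum_mul_left, tsum_mul_left, tsum_mul_left, tsum_mul_left]
  ring

/-- **(1.4) ⇒ (1.8)**: an interpolation basis satisfies the functional equation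
`F(τ,x) + (i/τ)^{d/2} F̃(−1/τ,x) = e^{πiτ|x|²}` for all `τ ∈ ℍ`, `x ∈ ℝᵈ`, where `F`, `F̃` are the
generating functions (1.6)–(1.7) of `(aₙ, bₙ)` and `(ãₙ, b̃ₙ)` (CKMRV §1.5: "the interpolation
formula (1.4) for `x ↦ e^{πiτ|x|²}` amounts to the identity (1.8)"). [cite: CohnEtAl2019, §1.5 (1.8)] -/
theorem IsInterpolationBasis.genFun_functionalEquation {n₀ : ℕ}
    {a b a' b' : ℕ → 𝓢(EuclideanSpace ℝ (Fin d), ℂ)} (h : IsInterpolationBasis d n₀ a b a' b')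
    (τ : ℍ) (x : EuclideanSpace ℝ (Fin d)) :
    genFun n₀ (fun n => ⇑(a n)) (fun n => ⇑(b n)) τ x +
        (I / (τ : ℂ)) ^ ((d : ℂ) / 2) * genFun n₀ (fun n => ⇑(a' n)) (fun n => ⇑(b' n)) (-(τ : ℂ)⁻¹) x =
      cexp (Real.pi * I * (τ : ℂ) * ‖x‖ ^ 2) := by
  rw [← interpolationSum_complexGaussian, ← complexGaussian_apply τ x]
  exact (h.eq_tsum _ (isRadial_complexGaussian τ) x).symm

/-- **(1.8) ⇒ (1.4) for complex Gaussians** (the last step of the proof of CKMRV Theorem 3.1: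
"it suffices to prove that `Λ(f)` vanishes when `f` is a complex Gaussian … This condition amounts
to the functional equation `F(τ,x₀) + (i/τ)^{d/2} F̃(−1/τ,x₀) = e^{πiτ|x₀|²}`, because
`f̂(x) = (i/τ)^{d/2} e^{πi(−1/τ)|x|²}`"): if the generating functions of a family satisfy (1.8) at
`(τ, x)`, then the interpolation formula (1.4) holds for `f = e^{πiτ|·|²}` at `x`.
[cite: CohnEtAl2019, §3.1 (proof of Theorem 3.1)] -/
theorem eq_interpolationSum_complexGaussian_of_functionalEquation (n₀ : ℕ)
    (a b a' b' : ℕ → EuclideanSpace ℝ (Fin d) → ℂ) (τ : ℍ) (x : EuclideanSpace ℝ (Fin d))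
    (hFE : genFun n₀ a b τ x + (I / (τ : ℂ)) ^ ((d : ℂ) / 2) * genFun n₀ a' b' (-(τ : ℂ)⁻¹) x =
      cexp (Real.pi * I * (τ : ℂ) * ‖x‖ ^ 2)) :
    complexGaussian (EuclideanSpace ℝ (Fin d)) τ x =
      (∑' n, radialValue (complexGaussian (EuclideanSpace ℝ (Fin d)) τ) (node n₀ n) * a n x) +
      (∑' n, radialDeriv (complexGaussian (EuclideanSpace ℝ (Fin d)) τ) (node n₀ n) * b n x) +
      (∑' n, radialValue (𝓕 (complexGaussian (EuclideanSpace ℝ (Fin d)) τ) :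
        𝓢(EuclideanSpace ℝ (Fin d), ℂ)) (node n₀ n) * a' n x) +
      (∑' n, radialDeriv (𝓕 (complexGaussian (EuclideanSpace ℝ (Fin d)) τ) :
        𝓢(EuclideanSpace ℝ (Fin d), ℂ)) (node n₀ n) * b' n x) := by
  rw [interpolationSum_complexGaussian, hFE, complexGaussian_apply]

end GeneratingFunction

end Literature.Analysis.Fourier
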